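import Mathlib
import Literature.NumberTheory.LFunctions.WeilWindowSimpleEven
import Literature.NumberTheory.LFunctions.WeilExplicitProofs

/-!
# Sign-cone duality (stmt-RiemannHypothesis-16304), line Sketch — stub `stub_conclusion`

Repackaging of node multipliers as a fake von Mangoldt weight. Given multipliers `l n ≥ 0` on the
nodes `2 ≤ n < N` such that, for every Weil test function `g` supported in `[-a, a]` and
`G := g ⋆ g̃`, `∑_{2 ≤ n < N} l n · Re G(log n) ≤ Re W_ar(G) + Re G(0)` (with the prime-free Weil
form `W_ar := weilPolarTerm + weilArchTerm`), the weight `c n := l n · √n / 2` on the nodes (and `0`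
elsewhere, in particular `c 0 = c 1 = 0`) satisfies
`-∫ ‖g‖² ≤ Re (W_ar(G) - ∑' n, c n · n^{-1/2} (G(log n) + G(-log n)))`.
Indeed the `∑'` is a finite sum over the nodes, `Re (G(log n) + G(-log n)) = 2 Re G(log n)` by the
hermitian symmetry `conj G(-t) = G(t)` (`conj_weilConv_weilReflect_neg`), so the `n`-th term has real
part `l n · Re G(log n)`, and `G(0) = ∫ ‖g‖²` (`weilConv_weilReflect_apply_zero`).

Support file for the crux skeleton `SignConeDuality`.
-/

noncomputable section

-- `Summit.RiemannHypothesis.RiemannHypothesis.…` repeats a namespace component by design (D-0017 layout).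
set_option linter.dupNamespace false

open scoped BigOperators ComplexConjugate
open Complex MeasureTheory Set

namespace Summit.RiemannHypothesis.RiemannHypothesis.Theorems.SignConeDuality

open Literature.NumberTheory.LFunctions

/-- The `n`-th term of the fake prime sum: for a hermitian kernel `G` (`conj G(-t) = G(t)`, e.g.
`G = g ⋆ g̃` by `conj_weilConv_weilReflect_neg`), a real weight `w` and `x > 0`,
`Re ((w √x / 2) / √x · (G t + G (-t))) = w · Re G(t)`. -/
theorem conclusion_re_term (G : ℝ → ℂ) (hG : ∀ t, conj (G (-t)) = G t) (w : ℝ) {x : ℝ}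
    (hx : 0 < x) (t : ℝ) :
    (((w * Real.sqrt x / 2 : ℝ) : ℂ) / (Real.sqrt x : ℂ) * (G t + G (-t))).re = w * (G t).re := by
  have hre : (G (-t)).re = (G t).re := by rw [← hG t, Complex.conj_re]
  rw [← Complex.ofReal_div, Complex.re_ofReal_mul, Complex.add_re, hre]
  have hs : Real.sqrt x ≠ 0 := (Real.sqrt_pos.2 hx).ne'
  field_simp
  ring

/-- **Fake von Mangoldt weight from node multipliers.** If `l n ≥ 0` (`2 ≤ n < N`) satisfy
`∑_{2 ≤ n < N} l n · Re G(log n) ≤ Re W_ar(G) + Re G(0)` for every Weil test function `g` supported in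
`[-a, a]` (`G = g ⋆ g̃`, `W_ar = weilPolarTerm + weilArchTerm`), then the weight
`c n = l n · √n / 2` on the nodes, `0` elsewhere, is nonnegative, vanishes at `n = 1`, and satisfies
`-∫ ‖g‖² ≤ Re (W_ar(G) - ∑' n, c n n^{-1/2} (G(log n) + G(-log n)))` for all such `g`. -/
theorem stub_conclusion : ∀ (a : ℝ) (N : ℕ) (l : ℕ → ℝ), (∀ n, 0 ≤ l n) →
    (∀ g : ℝ → ℂ, IsWeilTest g → tsupport g ⊆ Set.Icc (-a) a →
      ∑ n ∈ Finset.Ico 2 N, l n * (weilConv g (weilReflect g) (Real.log n)).re ≤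
        (weilPolarTerm (weilConv g (weilReflect g)) +
            weilArchTerm (weilConv g (weilReflect g))).re +
          (weilConv g (weilReflect g) 0).re) →
    ∃ c : ℕ → ℝ, (∀ n, 0 ≤ c n) ∧ c 1 = 0 ∧
      ∀ g : ℝ → ℂ, IsWeilTest g → tsupport g ⊆ Set.Icc (-a) a →
        -(∫ t, ‖g t‖ ^ 2) ≤
          ((weilPolarTerm (weilConv g (weilReflect g)) +
                weilArchTerm (weilConv g (weilReflect g))) -
            ∑' n : ℕ, ((c n : ℝ) : ℂ) / (Real.sqrt n : ℂ) *
              (weilConv g (weilReflect g) (Real.log n) +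
                weilConv g (weilReflect g) (-Real.log n))).re := by
  intro a N l hl0 hl
  refine ⟨fun n => if n ∈ Finset.Ico 2 N then l n * Real.sqrt n / 2 else 0, ?_, ?_, ?_⟩
  · intro n
    show 0 ≤ (if n ∈ Finset.Ico 2 N then l n * Real.sqrt n / 2 else 0)
    by_cases hn : n ∈ Finset.Ico 2 N
    · rw [if_pos hn]
      exact div_nonneg (mul_nonneg (hl0 n) (Real.sqrt_nonneg _)) zero_le_two
    · rw [if_neg hn]
  · show (if (1 : ℕ) ∈ Finset.Ico 2 N then l 1 * Real.sqrt ((1 : ℕ) : ℝ) / 2 else 0) = 0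
    have h1 : (1 : ℕ) ∉ Finset.Ico 2 N := by simp
    rw [if_neg h1]
  · intro g hg hsupp
    have hlg := hl g hg hsupp
    have h0 : (weilConv g (weilReflect g) 0).re = ∫ t, ‖g t‖ ^ 2 := by
      rw [weilConv_weilReflect_apply_zero, Complex.ofReal_re]
    have hsum :
        (∑' n : ℕ, (((if n ∈ Finset.Ico 2 N then l n * Real.sqrt n / 2 else 0 : ℝ)) : ℂ) /
              (Real.sqrt n : ℂ) *
            (weilConv g (weilReflect g) (Real.log n) +
              weilConv g (weilReflect g) (-Real.log n))).re =
          ∑ n ∈ Finset.Ico 2 N, l n * (weilConv g (weilReflect g) (Real.log n)).re := by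
      rw [tsum_eq_sum (s := Finset.Ico 2 N) (fun n hn => by simp [hn]), Complex.re_sum]
      refine Finset.sum_congr rfl (fun n hn => ?_)
      rw [if_pos hn]
      have hn2 : 2 ≤ n := (Finset.mem_Ico.1 hn).1
      have hx : (0 : ℝ) < n := by exact_mod_cast lt_of_lt_of_le two_pos hn2
      exact conclusion_re_term _ (conj_weilConv_weilReflect_neg g) (l n) hx (Real.log n)
    rw [Complex.sub_re, hsum]
    linarith [hlg, h0]

end Summit.RiemannHypothesis.RiemannHypothesis.Theorems.SignConeDuality

end
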